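import Summits.Ventures.LatticeQCDFlow.Scaling.SimulatedTemperingFiniteCeiling
import Summits.Ventures.LatticeQCDFlow.Scaling.LadderFloor

/-!
HONEST FRAMING: exact (Metropolis-corrected) sampling algorithms for lattice gauge theory; figures
of merit are autocorrelation/cost numbers at stated couplings and volumes; no continuum-physics
claim.

# SimulatedTemperingFiniteFloor — THE FLOOR FOR THE SAME OBJECT, AND THE TWO-SIDED LAW: for the finite
# random-scan simulated-tempering sampler `τ_int(level) ≥ K(K+1)(K+2)/(6t·Σ_k ov_k) − ½ ≥ (K+1)(K+2)/(6t) − ½`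
# WHATEVER the within-level update; with the ceiling of `Scaling/SimulatedTemperingFiniteCeiling`:
# `(K+1)(K+2)/3 − ½ ≤ τ_int(level) ≤ 8(K+1)²/(a·min{1,γ_M}) − ½` at `t = ½` (lean-2 GEN-16, ours)

Venture-side (OURS).  Cell `lqcd-flow` (pub-lqcd), unit `pub-lqcd-lean-2-g16`, 2026-08-24.  GEN-13
(`Scaling/SimulatedTemperingDiffusive`, `TemperingLevelTauInt`) proved the diffusive floor for the coupling index
at KERNEL level on general spaces.  This file proves it for the FINITE sampler of this chapter, in the same
finite-chain currency as the ceiling (`asympVar/(2·Var)`, Madras–Slade), so that floor and ceiling concern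
LITERALLY THE SAME OBJECT `stFinSampler t μ M`: the Madras–Slade bound `τ_int,g ≥ 1/(1 − ρ_g(1)) − ½`
(Literature `asympVar_mul_dirichletForm_ge`, Proposition 9.2.2) with `C_g(0) − C_g(1) = 𝓔_P(g)` ((9.2.28)), the
EXACT Dirichlet form of a function of the level, `𝓔_P(g∘lev) = (t/(2(K+1)))·Σ_{k<K} ov_k (g(k+1) − g(k))²`
(the within-level updates are invisible), and `Var_unif(level) = K(K+2)/12`.

* §1 (`Scaling/LadderFloor.lawVariance_uniform_level`: `Var_unif(k ↦ k) = K(K+2)/12`.)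
* §2 **`stFin_dirichletForm_comp_fst`** — `𝓔_π(P; g∘fst) = (t/(2(K+1)))·Σ_{k<K} ov(k,k+1)(g(k+1) − g(k))²`;
  `stFin_dirichletForm_level` — for the level itself `= (t/(2(K+1)))·Σ_{k<K} ov(k,k+1)`.
* §3 **`stFin_tauInt_level_ge`** — `τ_int(level) := asympVar/(2Var) ≥ K(K+1)(K+2)/(6t·Σ_k ov_k) − ½` for EVERY
  exact, reversible, irreducible within-level update (`0 < t < 1`); **`stFin_tauInt_level_ge_kfree`** —
  `≥ (K+1)(K+2)/(6t) − ½` (overlaps `≤ 1`): at least `Θ(K²/t)` steps whatever the ladder and the update;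
  **`stFinHalf_tauInt_level_twoSided`** — at `t = ½`:
  `(K+1)(K+2)/3 − ½ ≤ τ_int(level) ≤ 8(K+1)²/(a·min{1,γ_M}) − ½`.

NOT CLAIMED: general configuration spaces (GEN-13 has the floor there); floors for observables other than the
level; anything measured.  Literature grade (cell rule): KNOWN MECHANISM (Madras–Slade Prop. 9.2.2 / Cor. 9.2.3;
Katzgraber–Trebst–Huse–Troyer 2006 diffusive ladder), NEW TYPING (two-sided law for one finite sampler); nothing
cited as a fact; no new bib keys.
-/

noncomputable section

open Finset
open scoped Matrix
open Literature.Probability.MarkovChains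
open Literature.Probability.MarkovChains.Decomposition

namespace Summit.Ventures.LatticeQCDFlow.Scaling

/-! ## §1 The variance of the level under the uniform law: `lawVariance_uniform_level` of `Scaling/LadderFloor`
(`Var_unif(level) = K(K+2)/12`). -/

/-! ## §2 The Dirichlet form of a function of the level -/

section Floor

variable {S : Type*} [Fintype S] [DecidableEq S] {K : ℕ} {μ : Fin (K + 1) → S → ℝ}
  {M : Fin (K + 1) → Matrix S S ℝ} {t : ℝ}

/-- **The Dirichlet form of a function of the level is the ladder energy weighted by the overlaps:**
`𝓔_π(P; g∘fst) = (t/(2(K+1)))·Σ_{k<K} ov(k,k+1)·(g(k+1) − g(k))²` — within-level updates do not move the level.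
[ours] -/
theorem stFin_dirichletForm_comp_fst (hμ : ∀ k x, 0 < μ k x) (g : Fin (K + 1) → ℝ) :
    dirichletForm (stFinLaw μ) (stFinSampler t μ M) (fun p => g p.1)
      = t / (2 * (K + 1)) * ∑ k : Fin K, stFinOverlap μ k.castSucc k.succ * (g k.succ - g k.castSucc) ^ 2 := by
  -- group the double sum by levels: `Σ_i Σ_j blockFlow(i,j)(g i − g j)²`
  have hgroup : ∑ p : Fin (K + 1) × S, ∑ q : Fin (K + 1) × S,
      stFinLaw μ p * stFinSampler t μ M p q * (g p.1 - g q.1) ^ 2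
        = ∑ i : Fin (K + 1), ∑ j : Fin (K + 1),
            blockFlow (stFinLaw μ) (stFinSampler t μ M) Prod.fst i j * (g i - g j) ^ 2 := by
    symm
    calc ∑ i : Fin (K + 1), ∑ j : Fin (K + 1),
          blockFlow (stFinLaw μ) (stFinSampler t μ M) Prod.fst i j * (g i - g j) ^ 2
        = ∑ i : Fin (K + 1), ∑ j : Fin (K + 1), ∑ x : S, ∑ y : S,
            stFinLaw μ (i, x) * stFinSampler t μ M (i, x) (j, y) * (g i - g j) ^ 2 := by
          refine sum_congr rfl fun i _ => sum_congr rfl fun j _ => ?_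
          unfold blockFlow
          rw [sum_block_fst, Finset.sum_mul]
          refine sum_congr rfl fun x _ => ?_
          rw [sum_block_fst, Finset.sum_mul]
      _ = ∑ i : Fin (K + 1), ∑ x : S, ∑ j : Fin (K + 1), ∑ y : S,
            stFinLaw μ (i, x) * stFinSampler t μ M (i, x) (j, y) * (g i - g j) ^ 2 :=
          sum_congr rfl fun i _ => Finset.sum_comm
      _ = ∑ p : Fin (K + 1) × S, ∑ q : Fin (K + 1) × S,
            stFinLaw μ p * stFinSampler t μ M p q * (g p.1 - g q.1) ^ 2 := by
          simp only [Fintype.sum_prod_type]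
  -- off the diagonal the flow is the overlap; on the diagonal the square vanishes
  have hterm : ∀ i j : Fin (K + 1), blockFlow (stFinLaw μ) (stFinSampler t μ M) Prod.fst i j * (g i - g j) ^ 2
      = t / (2 * (K + 1)) * ((if j.val = i.val + 1 then stFinOverlap μ i j * (g i - g j) ^ 2 else 0)
          + (if i.val = j.val + 1 then stFinOverlap μ i j * (g i - g j) ^ 2 else 0)) := by
    intro i j
    by_cases hij : i = j
    · subst hij; simp
    rw [stFin_blockFlow_of_ne hμ hij]
    by_cases hadj : (j.val = i.val + 1 ∨ i.val = j.val + 1)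
    · rw [if_pos hadj]
      rcases hadj with h | h
      · rw [if_pos h, if_neg (by omega)]; ring
      · rw [if_neg (by omega), if_pos h]; ring
    · rw [if_neg hadj, if_neg (fun h => hadj (Or.inl h)), if_neg (fun h => hadj (Or.inr h))]; ring
  unfold dirichletForm
  rw [hgroup]
  simp_rw [hterm, ← Finset.mul_sum, Finset.sum_add_distrib]
  rw [sum_sum_ite_val_succ (fun i j => stFinOverlap μ i j * (g i - g j) ^ 2),
    sum_sum_ite_val_pred (fun i j => stFinOverlap μ i j * (g i - g j) ^ 2)]
  have hsym : ∑ k : Fin K, stFinOverlap μ k.succ k.castSucc * (g k.succ - g k.castSucc) ^ 2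
      = ∑ k : Fin K, stFinOverlap μ k.castSucc k.succ * (g k.succ - g k.castSucc) ^ 2 :=
    sum_congr rfl fun k _ => by rw [stFinOverlap_comm]
  rw [hsym]
  have e : ∀ k : Fin K, (g k.castSucc - g k.succ) ^ 2 = (g k.succ - g k.castSucc) ^ 2 := fun k => by ring
  simp_rw [e]
  ring

/-- For the level itself: `𝓔_π(P; level) = (t/(2(K+1)))·Σ_{k<K} ov(k,k+1)`. [ours] -/
theorem stFin_dirichletForm_level (hμ : ∀ k x, 0 < μ k x) :
    dirichletForm (stFinLaw μ) (stFinSampler t μ M) (fun p => (p.1 : ℝ))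
      = t / (2 * (K + 1)) * ∑ k : Fin K, stFinOverlap μ k.castSucc k.succ := by
  rw [stFin_dirichletForm_comp_fst (M := M) hμ (fun i => (i : ℝ))]
  congr 1
  refine sum_congr rfl fun k _ => ?_
  have : ((k.succ : Fin (K + 1)) : ℝ) - ((k.castSucc : Fin (K + 1)) : ℝ) = 1 := by
    rw [Fin.val_succ, Fin.val_castSucc]; push_cast; ring
  rw [this, one_pow, mul_one]

omit [DecidableEq S] in
/-- The variance of the level under the target is that under the uniform law, `K(K+2)/12`. [ours] -/
theorem stFin_lawVariance_level (hμ1 : ∀ k, ∑ x, μ k x = 1) :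
    lawVariance (stFinLaw μ) (fun p : Fin (K + 1) × S => (p.1 : ℝ)) = K * (K + 2) / 12 := by
  have hmean : lawMean (stFinLaw μ) (fun p : Fin (K + 1) × S => (p.1 : ℝ))
      = lawMean (fun _ : Fin (K + 1) => (1 : ℝ) / (K + 1)) (fun k => (k : ℝ)) := by
    unfold lawMean stFinLaw
    rw [Fintype.sum_prod_type]
    refine sum_congr rfl fun k _ => ?_
    dsimp only
    rw [← Finset.sum_mul, ← Finset.sum_div, hμ1]
  rw [← lawVariance_uniform_level K]
  unfold lawVariance
  rw [hmean]
  unfold stFinLaw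
  rw [Fintype.sum_prod_type]
  refine sum_congr rfl fun k _ => ?_
  dsimp only
  rw [← Finset.sum_mul, ← Finset.sum_div, hμ1]

/-! ## §3 The floor and the two-sided law -/

/-- **THE FLOOR FOR THE FINITE SAMPLER:** for EVERY exact (reversible, irreducible) within-level update,
`τ_int(level) := asympVar/(2Var) ≥ K(K+1)(K+2)/(6t·Σ_{k<K} ov(k,k+1)) − ½` (`0 < t < 1`, `K ≥ 1`) — the
Madras–Slade bound `τ_int ≥ 1/(1 − ρ(1)) − ½` with the exact Dirichlet form of the level. [ours] -/
theorem stFin_tauInt_level_ge (hK : 1 ≤ K) (hμ : ∀ k x, 0 < μ k x) (hμ1 : ∀ k, ∑ x, μ k x = 1)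
    (hM : ∀ k, IsRowStochastic (M k)) (hMrev : ∀ k, DetailedBalance (μ k) (M k))
    (hMirr : ∀ k, IsIrreducible (M k)) (ht0 : 0 < t) (ht1 : t < 1) :
    K * (K + 1) * (K + 2) / (6 * t * ∑ k : Fin K, stFinOverlap μ k.castSucc k.succ) - 1 / 2
      ≤ asympVar (fun p : Fin (K + 1) × S => (p.1 : ℝ)) (stFinLaw μ) (stFinSampler t μ M)
          / (2 * lawVariance (stFinLaw μ) (fun p : Fin (K + 1) × S => (p.1 : ℝ))) := by
  have hP := stFinSampler_isRowStochastic hμ hM ht0.le ht1.le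
  have hDB := stFinSampler_detailedBalance (t := t) hμ hMrev
  have hst : IsStationary (stFinLaw μ) (stFinSampler t μ M) := hDB.isStationary hP.2
  have hirr := stFinSampler_isIrreducible hμ hM hMirr ht0 ht1
  have key := asympVar_mul_dirichletForm_ge (stFinLaw_pos hμ) (sum_stFinLaw hμ1) hP hDB hirr
    (fun p : Fin (K + 1) × S => (p.1 : ℝ))
  have h928 := MadrasSlade1993_eq_9_2_28 hP hst (fun p : Fin (K + 1) × S => (p.1 : ℝ))
  set V := lawVariance (stFinLaw μ) (fun p : Fin (K + 1) × S => (p.1 : ℝ)) with hV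
  set C1 := piInner (stFinLaw μ) (centred (stFinLaw μ) (fun p : Fin (K + 1) × S => (p.1 : ℝ)))
    (stFinSampler t μ M *ᵥ centred (stFinLaw μ) (fun p : Fin (K + 1) × S => (p.1 : ℝ))) with hC1
  set v := asympVar (fun p : Fin (K + 1) × S => (p.1 : ℝ)) (stFinLaw μ) (stFinSampler t μ M) with hv
  set A := ∑ k : Fin K, stFinOverlap μ k.castSucc k.succ with hA
  have hE : V - C1 = t / (2 * (K + 1)) * A := by rw [h928, stFin_dirichletForm_level (M := M) hμ]
  have hVval : V = K * (K + 2) / 12 := stFin_lawVariance_level hμ1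
  have hKr : (1 : ℝ) ≤ K := by exact_mod_cast hK
  have hVpos : 0 < V := by rw [hVval]; positivity
  have hApos : 0 < A := by
    rw [hA]
    haveI : Nonempty (Fin K) := ⟨⟨0, by omega⟩⟩
    refine Finset.sum_pos (fun k _ => ?_) Finset.univ_nonempty
    unfold stFinOverlap
    haveI : Nonempty S := by
      by_contra h
      rw [not_nonempty_iff] at h
      have := hμ1 0
      rw [Finset.univ_eq_empty, Finset.sum_empty] at this
      exact zero_ne_one this
    exact Finset.sum_pos (fun x _ => lt_min (hμ _ x) (hμ _ x)) Finset.univ_nonempty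
  have hEpos : 0 < V - C1 := by rw [hE]; positivity
  -- from `V(V + C1) ≤ v(V − C1)`: `v/(2V) ≥ V/(V − C1) − ½ = K(K+1)(K+2)/(6tA) − ½`
  have htne : t ≠ 0 := ht0.ne'
  have hAne : A ≠ 0 := hApos.ne'
  have hX : (K : ℝ) * (K + 1) * (K + 2) / (6 * t * A) = V / (V - C1) := by
    rw [hE, hVval]
    field_simp
    ring
  have hEne : V - C1 ≠ 0 := hEpos.ne'
  have hX2 : V / (V - C1) - 1 / 2 = (2 * V - (V - C1)) / (2 * (V - C1)) := by
    field_simp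
  rw [hX, hX2, div_le_div_iff₀ (by positivity) (by positivity)]
  nlinarith [key]

/-- **THE LADDER-FREE FLOOR:** overlaps are at most `1`, so `τ_int(level) ≥ (K+1)(K+2)/(6t) − ½` — at least
`Θ(K²/t)` sampler steps whatever the levels and whatever the within-level update. [ours] -/
theorem stFin_tauInt_level_ge_kfree (hK : 1 ≤ K) (hμ : ∀ k x, 0 < μ k x) (hμ1 : ∀ k, ∑ x, μ k x = 1)
    (hM : ∀ k, IsRowStochastic (M k)) (hMrev : ∀ k, DetailedBalance (μ k) (M k))
    (hMirr : ∀ k, IsIrreducible (M k)) (ht0 : 0 < t) (ht1 : t < 1) :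
    (K + 1) * (K + 2) / (6 * t) - 1 / 2
      ≤ asympVar (fun p : Fin (K + 1) × S => (p.1 : ℝ)) (stFinLaw μ) (stFinSampler t μ M)
          / (2 * lawVariance (stFinLaw μ) (fun p : Fin (K + 1) × S => (p.1 : ℝ))) := by
  refine le_trans ?_ (stFin_tauInt_level_ge hK hμ hμ1 hM hMrev hMirr ht0 ht1)
  have hA1 : ∑ k : Fin K, stFinOverlap μ k.castSucc k.succ ≤ K := by
    calc ∑ k : Fin K, stFinOverlap μ k.castSucc k.succ ≤ ∑ _k : Fin K, (1 : ℝ) :=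
          sum_le_sum fun k _ => stFinOverlap_le_one hμ1 _ _
      _ = K := by simp
  have hApos : 0 < ∑ k : Fin K, stFinOverlap μ k.castSucc k.succ := by
    haveI : Nonempty (Fin K) := ⟨⟨0, by omega⟩⟩
    haveI : Nonempty S := by
      by_contra h
      rw [not_nonempty_iff] at h
      have := hμ1 0
      rw [Finset.univ_eq_empty, Finset.sum_empty] at this
      exact zero_ne_one this
    refine Finset.sum_pos (fun k _ => ?_) Finset.univ_nonempty
    exact Finset.sum_pos (fun x _ => lt_min (hμ _ x) (hμ _ x)) Finset.univ_nonempty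
  have hKr : (1 : ℝ) ≤ K := by exact_mod_cast hK
  apply sub_le_sub_right
  rw [div_le_div_iff₀ (by positivity) (by positivity)]
  have : (K + 1 : ℝ) * (K + 2) * (6 * t * ∑ k : Fin K, stFinOverlap μ k.castSucc k.succ)
      ≤ (K + 1) * (K + 2) * (6 * t * K) := by
    apply mul_le_mul_of_nonneg_left _ (by positivity)
    exact mul_le_mul_of_nonneg_left hA1 (by positivity)
  nlinarith [this]

/-- **THE TWO-SIDED LAW FOR ONE OBJECT (half-half scan):** for the finite simulated-tempering sampler with
exact weights, irreducible reversible within-level updates with Poincaré constant `γ_M`, adjacent overlaps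
`≥ a`, `K ≥ 1`:  `(K+1)(K+2)/3 − ½ ≤ τ_int(level) ≤ 8(K+1)²/(a·min{1,γ_M}) − ½`. [ours] -/
theorem stFinHalf_tauInt_level_twoSided (hK : 1 ≤ K) (hμ : ∀ k x, 0 < μ k x) (hμ1 : ∀ k, ∑ x, μ k x = 1)
    (hM : ∀ k, IsRowStochastic (M k)) (hMrev : ∀ k, DetailedBalance (μ k) (M k))
    (hMirr : ∀ k, IsIrreducible (M k)) {a γ : ℝ} (ha : 0 < a) (hγ : 0 < γ)
    (hov : ∀ i j : Fin (K + 1), (j.val = i.val + 1 ∨ i.val = j.val + 1) → a ≤ stFinOverlap μ i j)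
    (hgap : ∀ k, ∀ h : S → ℝ, γ * lawVariance (μ k) h ≤ dirichletForm (μ k) (M k) h) :
    (K + 1) * (K + 2) / 3 - 1 / 2
        ≤ asympVar (fun p : Fin (K + 1) × S => (p.1 : ℝ)) (stFinLaw μ) (stFinSampler (1 / 2) μ M)
            / (2 * lawVariance (stFinLaw μ) (fun p : Fin (K + 1) × S => (p.1 : ℝ)))
      ∧ asympVar (fun p : Fin (K + 1) × S => (p.1 : ℝ)) (stFinLaw μ) (stFinSampler (1 / 2) μ M)
            / (2 * lawVariance (stFinLaw μ) (fun p : Fin (K + 1) × S => (p.1 : ℝ)))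
        ≤ 8 * (K + 1) ^ 2 / (a * min 1 γ) - 1 / 2 := by
  refine ⟨?_, ?_⟩
  · have h := stFin_tauInt_level_ge_kfree (M := M) (t := 1 / 2) hK hμ hμ1 hM hMrev hMirr (by norm_num)
      (by norm_num)
    have e : ((K : ℝ) + 1) * (K + 2) / (6 * (1 / 2)) = (K + 1) * (K + 2) / 3 := by ring
    rwa [e] at h
  · have hV : 0 < lawVariance (stFinLaw μ) (fun p : Fin (K + 1) × S => (p.1 : ℝ)) := by
      rw [stFin_lawVariance_level hμ1]
      have hKr : (1 : ℝ) ≤ K := by exact_mod_cast hK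
      positivity
    exact stFinHalf_tauInt_le hK hμ hμ1 hM hMrev hMirr ha hγ hov hgap hV

end Floor

end Summit.Ventures.LatticeQCDFlow.Scaling

end
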